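import Literature.AlgebraicGeometry.HodgeTheory.BettiUniverseHodgeRiemann
import Literature.AlgebraicGeometry.HodgeTheory.HodgeRiemannDegreeOne
import HarnessLib

/-!
# The light trace of the Betti–Hodge universe against integration of forms:
# `trC = c · ∫_X` on top de Rham classes, `trC (η ∪ conj η') = c · ∫_X α ∧ ᾱ'`, and
# `Fᵏ(ℂ ⊗_ℚ Hᵏ) =` classes of closed `(k,0)`-forms, on any Hodge model

Family `hodge`, layer `Literature/AlgebraicGeometry/HodgeTheory`. Theorems only; no definition and
no named fact is introduced. Continuation of `BettiUniverseAxioms` (light form) /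
`BettiUniverseHodgeRiemann` (heavy form): the NORMALISATION of the complexified light trace
`BettiUniverse.trC hX (2n)` — by construction the coordinate functional along a CHOSEN basis vector
of the line `H^{2n}(X(ℂ); ℚ)` (`BettiUniverse.tr`, `lineBasis`), hence a non-zero multiple of the
integration trace but with no fixed orientation — against the integral `∫_M` of top-degree complex
forms on a Hodge model `M = X^an` of `X` (`Motives.cintegral`, descended to top de Rham cohomology
by Stokes: `cintegralClass`), read through the complexification `e ⊗ ℂ` of a real de Rham
comparison `e` (`complexifyFun`, Voisin I Cor. 6.12) and the comparison `Θ_B` of the model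
(`HodgeModel.complexification`).

Contents (all for `X` smooth projective of dimension `n`, `B` a Hodge model of `X`,
`e : DeRhamIsoFamily 𝓘(ℝ, B.model)`):

* `exists_eq_smul_of_finrank_eq_one` — two linear functionals on a line, the second non-zero, are
  proportional (linear algebra);
* `HodgeModel.finrank_real_model` — `dim_ℝ = 2n` for the model space;
* `BettiUniverse.trC_one_tmul`, `BettiUniverse.finrank_complexDeRhamCohomology_top` —
  `trC (1 ⊗ v) = tr v`; `dim_ℂ H^{2n}_dR(X^an; ℂ) = 1`;
* `BettiUniverse.exists_trC_eq_mul_cintegral` — **`trC = c · ∫`**: for a continuous orientation `o`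
  of `X^an` integrating some closed top form non-trivially there is `c ≠ 0` with
  `trC hX (2n) w = c · ∫_{X^an} F` whenever `Θ_B w = (e ⊗ ℂ)[F]` (both sides are non-zero linear
  functionals on the LINE `H^{2n}`, Hatcher Cor. 3.37 / Voisin I Thm. 5.30; `∫` descends by Stokes,
  Warner 4.9);
* `BettiUniverse.exists_trC_cup_conj_eq_mul_cintegral` — **`trC (η ∪ conj η') = c · ∫ α ∧ ᾱ'`**
  for `e` multiplicative (Warner Thm. 5.45: `e[α] ∪ e[β] = e[α ∧ β]`), `Θ_B η = (e ⊗ ℂ)[α]`,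
  `Θ_B η' = (e ⊗ ℂ)[α']`, in equal degrees `k + k = 2n` (`Θ'` is multiplicative,
  `BettiUniverse.ofRatClassBaseChange_cup2`, and intertwines `conj ⊗ id` with conjugation of classes,
  `HodgeModel.complexification_conj`, Voisin I Cor. 6.12; `e ⊗ ℂ` is real, `conjClass_complexifyFun`);
  `BettiUniverse.exists_trC_cup_conj_eq_mul_cintegral_surface` — the surface case `n = k = 2` in the
  spelling `trC hX 4 (cup X 2 2 ⊗ ℂ)` of `BettiUniverse.HodgeRiemann20`;
* `HodgeModel.complexification_cup2` — `Θ_B` is multiplicative in equal degrees (Hatcher Prop. 3.10);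
* `KaehlerRationalDatum.exists_orientation_cintegral_ne_zero` — the hypothesis on `o` holds for the
  complex orientation of a Kähler–rational datum (`∫ ωⁿ > 0`, Voisin I §3.1.3 Lemma 3.8), whence the
  unconditional package `KaehlerRationalDatum.exists_trC_cup_conj_eq_mul_cintegral` (`B := D.B`,
  `e := D.e`; such data exist for every smooth projective `X`, `nonempty_kaehlerRationalDatum`);
* `BettiUniverse.exists_closedForm_of_mem_hodge_F_self`, `BettiUniverse.mem_hodge_F_self_of_eq` —
  **`Fᵏ(ℂ ⊗_ℚ Hᵏ(X(ℂ); ℚ))` consists exactly of the `w` with `Θ_B w = (e ⊗ ℂ)[α]` for a closed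
  form `α` of type `(k, 0)` on `X^an`** (holomorphic `k`-forms; Voisin I §7.1.1 Def. 7.4 with the
  model-independence of `H^{p,q}`, Prop. 6.11), for every model `B` and natural `e`.

Method: linear algebra on the line `H^{2n}` plus the tree's comparison calculus
(`HodgeModel.complexification`, `DeRhamIsoFamily.complexifyEquiv`, `cupProduct_complexifyFun_mk`,
`cintegralClass`); no harmonic theory beyond what the imports already carry.

## References

* [VoisinHodgeI2002] C. Voisin, *Hodge Theory and Complex Algebraic Geometry I*, CUP 2002, §3.1.3
  Lemma 3.8, §5.3.2 Thm. 5.30, §6.1.3 Prop. 6.11 / Cor. 6.12, §6.3.2, §7.1.1 Def. 7.4, §7.1.2.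
* [WarnerGTM94] F. Warner, *Foundations of Differentiable Manifolds and Lie Groups*, GTM 94,
  Springer 1983, 4.8, Thm. 4.9 (Stokes), Thm. 5.36, Thm. 5.45.
* [HatcherAT2002] A. Hatcher, *Algebraic Topology*, CUP 2002, §3.3 Thm. 3.26 / Cor. 3.37.
-/

noncomputable section

open scoped Manifold ContDiff TensorProduct ComplexConjugate
open CategoryTheory Bundle Module
open Literature.AlgebraicTopology.SingularHomology
open Literature.Geometry.Kaehler
open Literature.NumberTheory.Transcendental
open Literature.AlgebraicGeometry.Motives (bettiCohomology ofRatClassBaseChange cintegral kaehlerFormPow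
  exists_orientation_integral_kaehlerFormPow_pos)

-- The identification `TangentSpace I x = E` is an abuse of definitional equality; as in the tree's
-- tangent-bundle files we let `isDefEq` unfold it.
set_option backward.isDefEq.respectTransparency false

namespace Literature.AlgebraicGeometry.HodgeTheory

/-! ### Linear algebra: two functionals on a line are proportional -/

section Line

variable {K V : Type*} [Field K] [AddCommGroup V] [Module K V]

/-- **Two linear functionals on a line are proportional**: if `dim V = 1` and `ψ ≠ 0` then every
`φ : V →ₗ K` is `c • ψ` for a (unique) scalar `c`. [folklore] -/
theorem exists_eq_smul_of_finrank_eq_one (h1 : finrank K V = 1) (φ ψ : V →ₗ[K] K) (hψ : ψ ≠ 0) :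
    ∃ c : K, φ = c • ψ := by
  obtain ⟨v, hv⟩ := DFunLike.ne_iff.1 hψ
  rw [LinearMap.zero_apply] at hv
  have hv0 : v ≠ 0 := fun h ↦ hv (by rw [h, map_zero])
  refine ⟨φ v / ψ v, LinearMap.ext fun w ↦ ?_⟩
  obtain ⟨a, rfl⟩ := (finrank_eq_one_iff_of_nonzero' v hv0).1 h1 w
  rw [LinearMap.smul_apply, map_smul, map_smul, smul_eq_mul, smul_eq_mul, smul_eq_mul]
  field_simp

/-- The scalar is non-zero when `φ` is. [folklore] -/
theorem exists_ne_zero_eq_smul_of_finrank_eq_one (h1 : finrank K V = 1) (φ ψ : V →ₗ[K] K)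
    (hφ : φ ≠ 0) (hψ : ψ ≠ 0) : ∃ c : K, c ≠ 0 ∧ φ = c • ψ := by
  obtain ⟨c, hc⟩ := exists_eq_smul_of_finrank_eq_one h1 φ ψ hψ
  refine ⟨c, ?_, hc⟩
  rintro rfl
  exact hφ (by rw [hc, zero_smul])

end Line

/-! ### Hodge models of a smooth projective variety: real dimension -/

section Model

variable {n : ℕ} {X : Motives.SchemeOver ℂ}

/-- `dim_ℝ E = 2n` for the model space `E ≅ ℂⁿ` of a Hodge model of an `n`-dimensional `X`
(`IsAnalytification.finrank_eq`). [cite: SerreGAGA1956, §2] -/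
theorem HodgeModel.finrank_real_model (B : HodgeModel n X) : finrank ℝ B.model = 2 * n := by
  rw [finrank_real_of_complex, B.isAnalytification.finrank_eq]

end Model

namespace BettiUniverse

/-! ### The line `H^{2n}`: the light trace and the top de Rham cohomology of a model -/

section TraceDeRham

variable {n : ℕ} {X : Motives.SchemeOver ℂ} (hX : Motives.IsSmoothProjective n X) (B : HodgeModel n X)

/-- `trC (1 ⊗ v) = tr v`. [folklore] -/
theorem trC_one_tmul (k : ℕ) (v : bettiCohomology X k) :
    trC hX k ((1 : ℂ) ⊗ₜ[ℚ] v) = (tr hX k v : ℂ) := by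
  rw [LinearMap.comp_apply, LinearMap.baseChange_tmul, LinearEquiv.coe_toLinearMap,
    TensorProduct.AlgebraTensorModule.rid_tmul, Rat.smul_one_eq_cast]

include hX in
/-- `dim_ℂ H^{2n}_dR(X^an; ℂ) = 1` (`dim_ℂ H^{2n}(X(ℂ); ℂ) = 1` transported along the comparison of
the model and the pull-back). [cite: HatcherAT2002, §3.3 Cor. 3.37] -/
theorem finrank_complexDeRhamCohomology_top :
    finrank ℂ (complexDeRhamCohomology B.model B.carrier (2 * n)) = 1 := by
  rw [(B.deRham B.carrier (2 * n)).finrank_eq, ← (B.pullbackEquiv (2 * n)).finrank_eq]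
  exact finrank_complexBetti_two_mul_eq_one hX

end TraceDeRham

/-! ### `trC = c · ∫` on top classes -/

section TraceIntegral

variable {n : ℕ} {X : Motives.SchemeOver ℂ} (hX : Motives.IsSmoothProjective n X) (B : HodgeModel n X)
  (e : DeRhamIsoFamily 𝓘(ℝ, B.model)) [MeasurableSpace B.model] [BorelSpace B.model]

/-- **The complexified light trace is a non-zero multiple of integration over `X^an`.** Let `X` be
smooth projective of dimension `n`, `B` a Hodge model (`X^an` compact), `e` a real de Rham comparison,
`o` a continuous orientation of `X^an` in top degree `m = 2n` integrating SOME closed top form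
non-trivially. Then there is `c ≠ 0` with `trC hX m w = c · ∫_{X^an} F` for every
`w ∈ ℂ ⊗_ℚ H^m(X(ℂ); ℚ)` and closed complex top form `F` with `Θ_B w = (e ⊗ ℂ)[F]`. Both
`w ↦ trC w` and `[F] ↦ ∫ F` (Stokes, `cintegralClass`) are non-zero linear functionals on the line
`H^{2n}` (`dim H^{2n}(X(ℂ); ℚ) = 1` for the connected compact `X(ℂ)`), hence proportional.
[cite: VoisinHodgeI2002, §5.3.2 Thm. 5.30 and §7.1.2] [cite: HatcherAT2002, §3.3 Thm. 3.26]
[cite: WarnerGTM94, Thm. 4.9] -/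
theorem exists_trC_eq_mul_cintegral {m : ℕ} (hm : m = 2 * n) [Fact (finrank ℝ B.model = m)]
    (o : (x : B.carrier) → Orientation ℝ (TangentSpace 𝓘(ℝ, B.model) x) (Fin m))
    (ho : IsContinuousOrientation o)
    (hI : ∃ F : cclosedSmoothForms B.model B.carrier m,
      cintegral o (F : MForm 𝓘(ℝ, B.model) B.carrier ℂ m) ≠ 0) :
    ∃ c : ℂ, c ≠ 0 ∧ ∀ (w : ℂ ⊗[ℚ] bettiCohomology X m) (F : cclosedSmoothForms B.model B.carrier m),
      B.complexification hX m w = complexifyFun e m (complexDeRhamCohomology.mk B.model B.carrier m F) →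
        trC hX m w = c * cintegral o (F : MForm 𝓘(ℝ, B.model) B.carrier ℂ m) := by
  subst hm
  haveI : CompactSpace B.carrier := by
    -- `X(ℂ)` is compact and the comparison map is a homeomorphism (landed as
    -- `HodgeModel.compactSpace_carrier` in `HypersurfaceHolomorphicForms`, not imported here)
    haveI := Motives.ComplexPoints.compactSpace_of_isSmoothProjective hX
    exact B.isAnalytification.homeomorph.symm.compactSpace
  -- the light trace read on top de Rham classes of the model: `φ [F] := trC (Θ_B⁻¹ ((e ⊗ ℂ)[F]))`
  set φ : complexDeRhamCohomology B.model B.carrier (2 * n) →ₗ[ℂ] ℂ :=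
    trC hX (2 * n) ∘ₗ ((B.complexification hX (2 * n)).symm.toLinearMap ∘ₗ
      (e.complexifyEquiv B.carrier (2 * n)).toLinearMap) with hφ_def
  have hφ : ∀ {w : ℂ ⊗[ℚ] bettiCohomology X (2 * n)}
      {c : complexDeRhamCohomology B.model B.carrier (2 * n)},
      B.complexification hX (2 * n) w = complexifyFun e (2 * n) c → φ c = trC hX (2 * n) w := by
    intro w c h
    change trC hX (2 * n) ((B.complexification hX (2 * n)).symm (e.complexifyEquiv B.carrier (2 * n) c)) = _
    rw [complexifyEquiv_apply, ← h, LinearEquiv.symm_apply_apply]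
  -- `φ ≠ 0`: `tr(v₀) ≠ 0` and `Θ_B`, `e ⊗ ℂ` are bijective
  have hφ0 : φ ≠ 0 := by
    intro h
    set w : ℂ ⊗[ℚ] bettiCohomology X (2 * n) := (1 : ℂ) ⊗ₜ[ℚ] ratTopVec hX with hw
    set c : complexDeRhamCohomology B.model B.carrier (2 * n) :=
      (e.complexifyEquiv B.carrier (2 * n)).symm (B.complexification hX (2 * n) w) with hc
    have hwc : B.complexification hX (2 * n) w = complexifyFun e (2 * n) c := by
      rw [hc, ← complexifyEquiv_apply, LinearEquiv.apply_symm_apply]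
    have h0 := hφ hwc
    rw [h, LinearMap.zero_apply, hw, trC_one_tmul] at h0
    exact tr_ratTopVec_ne_zero hX (by exact_mod_cast h0.symm)
  -- `∫ ≠ 0` on classes
  have hψ0 : cintegralClass o ho ≠ (0 : complexDeRhamCohomology B.model B.carrier (2 * n) →ₗ[ℂ] ℂ) := by
    obtain ⟨F, hF⟩ := hI
    intro h
    apply hF
    rw [← cintegralClass_mk o ho F, h, LinearMap.zero_apply]
  obtain ⟨c, hc0, hc⟩ := exists_ne_zero_eq_smul_of_finrank_eq_one
    (finrank_complexDeRhamCohomology_top hX B) φ (cintegralClass o ho) hφ0 hψ0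
  refine ⟨c, hc0, fun w F h ↦ ?_⟩
  rw [← hφ h, hc, LinearMap.smul_apply, cintegralClass_mk, smul_eq_mul]

omit [MeasurableSpace B.model] [BorelSpace B.model] in
/-- **`Θ_B` is multiplicative** (equal degrees): `Θ_B ((x ∪ y)) = Θ_B x ∪ Θ_B y` for the
complexified rational cup product `cup X k k ⊗ ℂ` (`Θ'` is multiplicative,
`BettiUniverse.ofRatClassBaseChange_cup2`, and so is the pull-back `B^*`, `cupProduct_map`).
[cite: HatcherAT2002, §3.2 Prop. 3.10] -/
theorem _root_.Literature.AlgebraicGeometry.HodgeTheory.HodgeModel.complexification_cup2 (k : ℕ)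
    (x y : ℂ ⊗[ℚ] bettiCohomology X k) :
    B.complexification hX (k + k) (LinearMap.BilinMap.baseChange ℂ (cup X k k) x y) =
      cupProduct rfl (B.complexification hX k x) (B.complexification hX k y) := by
  rw [HodgeModel.complexification_apply, HodgeModel.complexification_apply,
    HodgeModel.complexification_apply, ofRatClassBaseChange_cup2]
  exact cupProduct_map _ rfl _ _

/-- **`trC (η ∪ conj η') = c · ∫_{X^an} α ∧ ᾱ'`** in equal degrees `k + k = 2n`, for a MULTIPLICATIVE
real de Rham comparison `e` (`e[α] ∪ e[β] = e[α ∧ β]`, Warner Thm. 5.45) and the constant `c ≠ 0` of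
`exists_trC_eq_mul_cintegral` (same `B`, `e`, `o`; first conjunct): whenever `Θ_B η = (e ⊗ ℂ)[α]`
and `Θ_B η' = (e ⊗ ℂ)[α']` for closed complex `k`-forms `α, α'`,
`trC hX (k+k) ((cup X k k ⊗ ℂ) η (conj η')) = c · ∫ α ∧ ᾱ'` — `Θ_B` is multiplicative
(`HodgeModel.complexification_cup2`) and carries `conj ⊗ id` to conjugation of classes (Voisin I
Cor. 6.12, `HodgeModel.complexification_conj`), and `e ⊗ ℂ` is real (`conjClass_complexifyFun`) and
multiplicative (`cupProduct_complexifyFun_mk`). This is the cohomological reading of the sesquilinear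
pairing `(α, α') ↦ ∫_X α ∧ ᾱ'` of Voisin I §6.3.2 (the form `H_k` without its power of `ω`).
[cite: VoisinHodgeI2002, §6.3.2 and Cor. 6.12] [cite: WarnerGTM94, Thm. 5.45] -/
theorem exists_trC_cup_conj_eq_mul_cintegral (hem : e.IsMultiplicative) {k : ℕ} (hk : k + k = 2 * n)
    [Fact (finrank ℝ B.model = k + k)]
    (o : (x : B.carrier) → Orientation ℝ (TangentSpace 𝓘(ℝ, B.model) x) (Fin (k + k)))
    (ho : IsContinuousOrientation o)
    (hI : ∃ F : cclosedSmoothForms B.model B.carrier (k + k),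
      cintegral o (F : MForm 𝓘(ℝ, B.model) B.carrier ℂ (k + k)) ≠ 0) :
    ∃ c : ℂ, c ≠ 0 ∧
      (∀ (w : ℂ ⊗[ℚ] bettiCohomology X (k + k)) (F : cclosedSmoothForms B.model B.carrier (k + k)),
        B.complexification hX (k + k) w =
            complexifyFun e (k + k) (complexDeRhamCohomology.mk B.model B.carrier (k + k) F) →
          trC hX (k + k) w = c * cintegral o (F : MForm 𝓘(ℝ, B.model) B.carrier ℂ (k + k))) ∧
      ∀ (η η' : ℂ ⊗[ℚ] bettiCohomology X k) (α α' : cclosedSmoothForms B.model B.carrier k),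
        B.complexification hX k η = complexifyFun e k (complexDeRhamCohomology.mk B.model B.carrier k α) →
        B.complexification hX k η' = complexifyFun e k (complexDeRhamCohomology.mk B.model B.carrier k α') →
          trC hX (k + k) (LinearMap.BilinMap.baseChange ℂ (cup X k k) η (Motives.HodgeStructure.conj η')) =
            c * cintegral o ((α : MForm 𝓘(ℝ, B.model) B.carrier ℂ k).wedge
              (α' : MForm 𝓘(ℝ, B.model) B.carrier ℂ k).conj) := by
  haveI : WedgeFacts 𝓘(ℝ, B.model) B.carrier ℝ :=
    wedgeFacts_of_assoc 𝓘(ℝ, B.model) B.carrier ℝ (ContinuousAlternatingMap.WedgeAssoc_holds ℝ B.model ℝ)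
  haveI : WedgeFacts 𝓘(ℝ, B.model) B.carrier ℂ :=
    wedgeFacts_of_assoc 𝓘(ℝ, B.model) B.carrier ℂ (ContinuousAlternatingMap.WedgeAssoc_holds ℝ B.model ℂ)
  obtain ⟨c, hc0, hc⟩ := exists_trC_eq_mul_cintegral hX B e hk o ho hI
  refine ⟨c, hc0, hc, fun η η' α α' hη hη' ↦ ?_⟩
  -- the closed form `α ∧ ᾱ'`
  have hwc : (α : MForm 𝓘(ℝ, B.model) B.carrier ℂ k).wedge (α' : MForm 𝓘(ℝ, B.model) B.carrier ℂ k).conj ∈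
      cclosedSmoothForms B.model B.carrier (k + k) :=
    wedge_mem_cclosedSmoothForms α.2 (conj_mem_cclosedSmoothForms_holds α'.2)
  refine hc _ ⟨_, hwc⟩ ?_
  -- `Θ_B (η ∪ conj η') = (e ⊗ ℂ)[α] ∪ conj ((e ⊗ ℂ)[α']) = (e ⊗ ℂ)[α ∧ ᾱ']`
  rw [B.complexification_cup2 hX, B.complexification_conj hX, hη, hη', conjClass_complexifyFun,
    complexDeRhamCohomology.conj_mk, cupProduct_complexifyFun_mk hem rfl]
  rfl

/-- **The surface case, in the spelling of `BettiUniverse.HodgeRiemann20`**: `X` a smooth projective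
SURFACE, `B` a Hodge model, `e` a multiplicative real de Rham comparison, `o` a continuous
orientation of `X^an` (top degree `4`) integrating some closed `4`-form non-trivially. There is
`c ≠ 0` such that for all `η, η' ∈ ℂ ⊗_ℚ H²(X(ℂ); ℚ)` and closed complex `2`-forms `α, α'` on `X^an`
with `Θ_B η = (e ⊗ ℂ)[α]`, `Θ_B η' = (e ⊗ ℂ)[α']`:
`trC hX 4 ((cup X 2 2 ⊗ ℂ) η (conj η')) = c · ∫_{X^an} α ∧ ᾱ'`.
[cite: VoisinHodgeI2002, §6.3.2 and Cor. 6.12] [cite: WarnerGTM94, Thm. 5.45] -/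
theorem exists_trC_cup_conj_eq_mul_cintegral_surface (hn : n = 2) (hem : e.IsMultiplicative)
    [Fact (finrank ℝ B.model = 4)]
    (o : (x : B.carrier) → Orientation ℝ (TangentSpace 𝓘(ℝ, B.model) x) (Fin 4))
    (ho : IsContinuousOrientation o)
    (hI : ∃ F : cclosedSmoothForms B.model B.carrier 4,
      cintegral o (F : MForm 𝓘(ℝ, B.model) B.carrier ℂ 4) ≠ 0) :
    ∃ c : ℂ, c ≠ 0 ∧
      ∀ (η η' : ℂ ⊗[ℚ] bettiCohomology X 2) (α α' : cclosedSmoothForms B.model B.carrier 2),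
        B.complexification hX 2 η = complexifyFun e 2 (complexDeRhamCohomology.mk B.model B.carrier 2 α) →
        B.complexification hX 2 η' = complexifyFun e 2 (complexDeRhamCohomology.mk B.model B.carrier 2 α') →
          trC hX 4 (LinearMap.BilinMap.baseChange ℂ (cup X 2 2) η (Motives.HodgeStructure.conj η')) =
            c * cintegral o ((α : MForm 𝓘(ℝ, B.model) B.carrier ℂ 2).wedge
              (α' : MForm 𝓘(ℝ, B.model) B.carrier ℂ 2).conj) := by
  subst hn
  obtain ⟨c, hc0, -, hc⟩ := exists_trC_cup_conj_eq_mul_cintegral hX B e hem (k := 2) rfl o ho hI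
  exact ⟨c, hc0, hc⟩

end TraceIntegral

/-! ### The hypothesis on the orientation, for a Kähler–rational datum -/

section Orientation

variable {n : ℕ} {X : Motives.SchemeOver ℂ}

/-- **The complex orientation of a Kähler–rational datum integrates `ωⁿ` positively**, so the
hypothesis `hI` of `exists_trC_eq_mul_cintegral` holds for it: on the model `D.B` of a
Kähler–rational datum `D` of the smooth projective `X` there is, in top degree `m = 2n`, a (constant,
continuous) orientation `o₀` and a closed complex top form — `ω_gⁿ ⊗ 1` — with `∫ ≠ 0`
(`∫_{X^an} ω_gⁿ > 0`, Voisin I §3.1.3 Lemma 3.8, the tree's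
`exists_orientation_integral_kaehlerFormPow_pos`). [cite: VoisinHodgeI2002, §3.1.3 Lemma 3.8] -/
theorem _root_.Literature.AlgebraicGeometry.HodgeTheory.KaehlerRationalDatum.exists_orientation_cintegral_ne_zero
    (D : KaehlerRationalDatum n X) (hX : Motives.IsSmoothProjective n X) {m : ℕ} (hm : m = 2 * n)
    [MeasurableSpace D.B.model] [BorelSpace D.B.model] [Fact (finrank ℝ D.B.model = m)] :
    ∃ o₀ : Orientation ℝ D.B.model (Fin m),
      IsContinuousOrientation (I := 𝓘(ℝ, D.B.model)) (M := D.B.carrier) (fun _ ↦ o₀) ∧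
        ∃ F : cclosedSmoothForms D.B.model D.B.carrier m,
          cintegral (fun _ : D.B.carrier ↦ o₀) (F : MForm 𝓘(ℝ, D.B.model) D.B.carrier ℂ m) ≠ 0 := by
  subst hm
  haveI : CompactSpace D.B.carrier := by
    haveI := Motives.ComplexPoints.compactSpace_of_isSmoothProjective hX
    exact D.B.isAnalytification.homeomorph.symm.compactSpace
  haveI : ConnectedSpace D.B.carrier := D.B.connectedSpace_carrier hX
  -- work in the free dimension `d = dim_ℂ E`, then specialise `d = n`
  suffices h : ∀ {d : ℕ} (hd : finrank ℂ D.B.model = d) [Fact (finrank ℝ D.B.model = 2 * d)],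
      ∃ o₀ : Orientation ℝ D.B.model (Fin (2 * d)),
        IsContinuousOrientation (I := 𝓘(ℝ, D.B.model)) (M := D.B.carrier) (fun _ ↦ o₀) ∧
          ∃ F : cclosedSmoothForms D.B.model D.B.carrier (2 * d),
            cintegral (fun _ : D.B.carrier ↦ o₀) (F : MForm 𝓘(ℝ, D.B.model) D.B.carrier ℂ (2 * d)) ≠ 0 from
    h D.B.isAnalytification.finrank_eq
  intro d hd _
  subst hd
  obtain ⟨o₀, hcont, hpos⟩ :=
    exists_orientation_integral_kaehlerFormPow_pos (M := D.B.carrier) D.g D.isKaehler.1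
  refine ⟨o₀, hcont, ⟨(kaehlerFormPow D.g.toRiemannianMetric (finrank ℂ D.B.model)).ofReal,
    ofReal_mem_cclosedSmoothForms (kaehlerFormPow_mem_closedSmoothForms D.hω D.g D.isKaehler _)⟩, ?_⟩
  change cintegral (fun _ : D.B.carrier ↦ o₀)
    (kaehlerFormPow D.g.toRiemannianMetric (finrank ℂ D.B.model)).ofReal ≠ 0
  rw [Motives.cintegral_ofReal]
  exact_mod_cast hpos.ne'

/-- **Unconditional package for a Kähler–rational datum.** For `D` a Kähler–rational datum of the
smooth projective `n`-fold `X` (model `D.B`, natural multiplicative real comparison `D.e`) and equal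
degrees `k + k = 2n`: there are a constant continuous orientation `o₀` of `X^an` and `c ≠ 0` with
`trC hX (k+k) w = c · ∫ F` whenever `Θ w = (D.e ⊗ ℂ)[F]`, and
`trC hX (k+k) ((cup X k k ⊗ ℂ) η (conj η')) = c · ∫ α ∧ ᾱ'` whenever `Θ η = (D.e ⊗ ℂ)[α]`,
`Θ η' = (D.e ⊗ ℂ)[α']` (`exists_trC_cup_conj_eq_mul_cintegral` with its orientation hypothesis
discharged by `exists_orientation_cintegral_ne_zero`). Such data exist for every smooth projective `X`
(`nonempty_kaehlerRationalDatum`). [cite: VoisinHodgeI2002, §6.3.2, Cor. 6.12 and §3.1.3 Lemma 3.8]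
[cite: WarnerGTM94, Thm. 5.45] -/
theorem _root_.Literature.AlgebraicGeometry.HodgeTheory.KaehlerRationalDatum.exists_trC_cup_conj_eq_mul_cintegral
    (D : KaehlerRationalDatum n X) (hX : Motives.IsSmoothProjective n X) {k : ℕ} (hk : k + k = 2 * n)
    [MeasurableSpace D.B.model] [BorelSpace D.B.model] [Fact (finrank ℝ D.B.model = k + k)] :
    ∃ (o₀ : Orientation ℝ D.B.model (Fin (k + k))) (c : ℂ),
      IsContinuousOrientation (I := 𝓘(ℝ, D.B.model)) (M := D.B.carrier) (fun _ ↦ o₀) ∧ c ≠ 0 ∧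
      (∀ (w : ℂ ⊗[ℚ] bettiCohomology X (k + k)) (F : cclosedSmoothForms D.B.model D.B.carrier (k + k)),
        D.B.complexification hX (k + k) w =
            complexifyFun D.e (k + k) (complexDeRhamCohomology.mk D.B.model D.B.carrier (k + k) F) →
          trC hX (k + k) w =
            c * cintegral (fun _ : D.B.carrier ↦ o₀) (F : MForm 𝓘(ℝ, D.B.model) D.B.carrier ℂ (k + k))) ∧
      ∀ (η η' : ℂ ⊗[ℚ] bettiCohomology X k) (α α' : cclosedSmoothForms D.B.model D.B.carrier k),
        D.B.complexification hX k η =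
            complexifyFun D.e k (complexDeRhamCohomology.mk D.B.model D.B.carrier k α) →
        D.B.complexification hX k η' =
            complexifyFun D.e k (complexDeRhamCohomology.mk D.B.model D.B.carrier k α') →
          trC hX (k + k) (LinearMap.BilinMap.baseChange ℂ (cup X k k) η (Motives.HodgeStructure.conj η')) =
            c * cintegral (fun _ : D.B.carrier ↦ o₀) ((α : MForm 𝓘(ℝ, D.B.model) D.B.carrier ℂ k).wedge
              (α' : MForm 𝓘(ℝ, D.B.model) D.B.carrier ℂ k).conj) := by
  obtain ⟨o₀, ho, hI⟩ := D.exists_orientation_cintegral_ne_zero hX hk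
  obtain ⟨c, hc0, hA, hB⟩ :=
    BettiUniverse.exists_trC_cup_conj_eq_mul_cintegral hX D.B D.e D.isMultiplicative hk (fun _ ↦ o₀) ho hI
  exact ⟨o₀, c, ho, hc0, hA, hB⟩

end Orientation

/-! ### `Fᵏ(ℂ ⊗_ℚ Hᵏ)` = classes of closed `(k,0)`-forms, on any model -/

section Filtration

variable {n : ℕ} {X : Motives.SchemeOver ℂ}

/-- **An element of `Fᵏ(ℂ ⊗_ℚ Hᵏ(X(ℂ); ℚ))` is represented by a closed `(k,0)`-form on ANY Hodge
model, through ANY natural real de Rham comparison**: for `x ∈ (hodge hHD hX k).F k` there is a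
closed complex `k`-form `α` of type `(k, 0)` on `X^an = B.carrier` with `Θ_B x = (e ⊗ ℂ)[α]`.
(`Fᵏ Hᵏ = H^{k,0}`: `x` is of Hodge type `(k,0)` — `BettiUniverse.isOfHodgeType_of_mem_F_self` —, a
property testable in the model `B` with comparison `e ⊗ ℂ` by the model-independence of `H^{p,q}`
(`hI`, Voisin I Prop. 6.11), where `H^{k,0}` is the span of classes of closed `(k,0)`-forms, itself
the set of such classes, `exists_closedForm_of_mem_hodgePQ`.)
[cite: VoisinHodgeI2002, §7.1.1 Def. 7.4 and §6.1.3 Prop. 6.11] -/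
theorem exists_closedForm_of_mem_hodge_F_self (hHD : exists_isReal_hodgeModel)
    (hI : hodgePQ_independent_of_hodgeModel) (hX : Motives.IsSmoothProjective n X) (B : HodgeModel n X)
    {e : DeRhamIsoFamily 𝓘(ℝ, B.model)} (hnat : e.IsNatural) (k : ℕ)
    {x : ℂ ⊗[ℚ] bettiCohomology X k} (hx : x ∈ (hodge hHD hX k).F k) :
    ∃ α : cclosedSmoothForms B.model B.carrier k,
      IsOfType k 0 (α : MForm 𝓘(ℝ, B.model) B.carrier ℂ k) ∧
        B.complexification hX k x = complexifyFun e k (complexDeRhamCohomology.mk B.model B.carrier k α) := by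
  -- the model `B'` with comparison `e ⊗ ℂ`
  let B' : HodgeModel n X :=
    { B with
      deRham := e.complexify
      deRham_isNatural := DeRhamIsoFamily.complexify_isNatural hnat }
  have h' : B'.pullback k (ofRatClassBaseChange (Motives.ComplexPoints X) k x) ∈ B'.hodgePQ k k 0 :=
    (hI.isOfHodgeType_iff hX B').1 (isOfHodgeType_of_mem_F_self hHD hX k hx)
  change B.pullback k _ ∈ (hodgePQ B.model B.carrier k k 0).map
    (e.complexifyEquiv B.carrier k).toLinearMap at h'
  obtain ⟨c, hc, hcx⟩ := Submodule.mem_map.1 h'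
  obtain ⟨α, hα, rfl⟩ := exists_closedForm_of_mem_hodgePQ hc (Nat.add_zero k)
  exact ⟨α, hα, by rw [HodgeModel.complexification_apply, ← hcx]; rfl⟩

/-- **Conversely, classes of closed `(k,0)`-forms lie in `Fᵏ`**: if `Θ_B x = (e ⊗ ℂ)[α]` for a closed
complex `k`-form `α` of type `(k, 0)` on a Hodge model `B` (any natural real `e`), then
`x ∈ (hodge hHD hX k).F k`. [cite: VoisinHodgeI2002, §7.1.1 Def. 7.4 and §6.1.3 Prop. 6.11] -/
theorem mem_hodge_F_self_of_eq (hHD : exists_isReal_hodgeModel)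
    (hI : hodgePQ_independent_of_hodgeModel) (hX : Motives.IsSmoothProjective n X) (B : HodgeModel n X)
    {e : DeRhamIsoFamily 𝓘(ℝ, B.model)} (hnat : e.IsNatural) (k : ℕ)
    {x : ℂ ⊗[ℚ] bettiCohomology X k} {α : cclosedSmoothForms B.model B.carrier k}
    (hα : IsOfType k 0 (α : MForm 𝓘(ℝ, B.model) B.carrier ℂ k))
    (hx : B.complexification hX k x = complexifyFun e k (complexDeRhamCohomology.mk B.model B.carrier k α)) :
    x ∈ (hodge hHD hX k).F k := by
  let B' : HodgeModel n X :=
    { B with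
      deRham := e.complexify
      deRham_isNatural := DeRhamIsoFamily.complexify_isNatural hnat }
  -- `Θ' x` is of Hodge type `(k, 0)`, witnessed in `B'`
  have hT : IsOfHodgeType n X k k 0 (ofRatClassBaseChange (Motives.ComplexPoints X) k x) := by
    refine ⟨B', ?_⟩
    change B.pullback k _ ∈ (hodgePQ B.model B.carrier k k 0).map (e.complexifyEquiv B.carrier k).toLinearMap
    rw [← B.complexification_apply hX, hx]
    exact Submodule.mem_map.2 ⟨_, Submodule.subset_span ⟨α, hα, rfl⟩, rfl⟩
  -- hence `x ∈ Θ_A⁻¹(H^{k,0}) ⊆ Fᵏ` for the chosen real model `A`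
  rw [hodge_F, HodgeModel.ratF_eq_iSup]
  have hmem : x ∈ (realHodgeModel hHD hX).ratPiece hX k k 0 := by
    rw [HodgeModel.mem_ratPiece_iff, HodgeModel.complexification_apply]
    exact (hI.isOfHodgeType_iff hX (realHodgeModel hHD hX)).1 hT
  refine Submodule.mem_iSup_of_mem ⟨(k, 0), Finset.HasAntidiagonal.mem_antidiagonal.2 (by omega)⟩ ?_
  exact Submodule.mem_iSup_of_mem (by push_cast; omega) hmem

end Filtration

end BettiUniverse

end Literature.AlgebraicGeometry.HodgeTheory

end
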